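import Summits.CriticalPhenomena.PercolationContinuityZ3.Theorems.Transplant.GrigorchukLamplighterStandardGensNoGo
import Summits.CriticalPhenomena.PercolationContinuityZ3.Theorems.Transplant.GrigorchukTorsion
import HarnessLib

/-!
# The Γ₂ one-lamp no-go UNCONDITIONAL: «GrigorchukLamplighterStandardGensNoGo» (p589680) with its hypothesis `htor` discharged by Grigorchuk's torsion theorem
# «GrigorchukTorsion» — no designed transversal for Cay(ℤ ≀_X 𝔊; a, b, c, d, s) through any finite-index subgroup of `Γ₂`

builds on p205010 (kernel theorem, internal audit signed; external expert review pending) — nothing in this file uses p205010; scope record, pure group theory,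
no percolation statement, no node touched.  Lane `prim-bschramm`, seat `prim-bschramm-p3` gen 35 (DESIGN OWNER; `run/shared/lean/prim/bschramm/P3-NILPOTENT.md`
§28.6, the customer file of the O7 plan, lead g25 rulings 2026-08-28).  Helper file (`--supports stmt-CriticalPhenomena-4575 --as helper`).  Def-free; a NEW file —
p589680 is not edited.  NOTHING about growth or amenability of `𝔊`; nothing about `BenjaminiSchramm1996_conj4_endState`; `θ(p_c) = 0` on
`Cay(ℤ ≀_X 𝔊; a, b, c, d, s)` stays NOT PROVED in the tree and not in print — this only says, now without any hypothesis, that the orbit theorem (N3-a) through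
subgroups of `Γ₂` cannot be the proof (caveat (α): subgroups of `Aut(Cay)` outside `Γ₂` untouched).
[cite: Grigorchuk1980, Theorem: every element of the group has finite order] [cite: BartholdiErschler2012, §2 (standard generating set)]
[cite: BenjaminiSchramm1996, Conj. 4; §2 (Cayley graphs)]
-/

noncomputable section

namespace Summit.CriticalPhenomena.PercolationContinuityZ3.Theorems.Transplant

namespace Grigorchuk

/-- **NO DESIGNED TRANSVERSAL ON `ℤ ≀_X 𝔊` WITH ONE LAMP LETTER — UNCONDITIONAL.**  For every finite set `S ⊆ Γ₂` of letters each of which has trivial lamp part or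
is the lamp letter `s = (ρ ↦ 1)`, every finite-index `Γ₀ ≤ Γ₂`, every finite right transversal, every `c : Γ₀ → ℤ²`, every `N ≥ 1`: the letter-form step condition of
`CayleyCosets.conj4_of_cosetLetters` fails (`wreathZ_not_cosetSteps_of_torsion` with `htor := isOfFinOrder_of_mem`). [cite: Grigorchuk1980, every element has finite order]
[cite: BartholdiErschler2012, §2 (standard generating set)] -/
theorem wreathZ_not_cosetSteps (S : Finset ↥wreathZ) (hS : ∀ x ∈ S, ((x : ↥wreathZ) : LampGroup ℤ).left = 1 ∨ x = sW)
    (Γ₀ : Subgroup ↥wreathZ) [Γ₀.FiniteIndex] (R : Finset ↥wreathZ)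
    (hRt : ∀ r ∈ R, ∀ r' ∈ R, ∀ a : Γ₀, (a : ↥wreathZ) * r = r' → r = r')
    (hRc : ∀ g : ↥wreathZ, ∃ a : Γ₀, ∃ r ∈ R, (a : ↥wreathZ) * r = g)
    (c : Γ₀ →* Multiplicative (Fin 2 → ℤ)) (N : ℕ) (hN : 1 ≤ N)
    (hstep : ∀ r ∈ R, ∀ (i : Fin 2) (σ : ℤˣ), ∃ x : ↥wreathZ, (x ∈ S ∨ x⁻¹ ∈ S) ∧ ∃ (a : Γ₀) (r' : ↥wreathZ), r' ∈ R ∧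
      r * x = (a : ↥wreathZ) * r' ∧ Multiplicative.toAdd (c a) = Pi.single i ((N : ℤ) * σ)) : False :=
  wreathZ_not_cosetSteps_of_torsion (fun _ hg => isOfFinOrder_of_mem hg) S hS Γ₀ R hRt hRc c N hN hstep

/-- **Bartholdi–Erschler's own Cayley graph `Cay(ℤ ≀_X 𝔊; a, b, c, d, s)`: the orbit theorem's designed-transversal input does not exist — UNCONDITIONAL**
(`wreathZ_standardGens_not_cosetSteps` with `htor` discharged). [cite: Grigorchuk1980, every element has finite order] [cite: BartholdiErschler2012, §2, Thm. 5.3] -/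
theorem wreathZ_standardGens_not_cosetSteps' [DecidableEq ↥wreathZ]
    (Γ₀ : Subgroup ↥wreathZ) [Γ₀.FiniteIndex] (R : Finset ↥wreathZ)
    (hRt : ∀ r ∈ R, ∀ r' ∈ R, ∀ a : Γ₀, (a : ↥wreathZ) * r = r' → r = r')
    (hRc : ∀ g : ↥wreathZ, ∃ a : Γ₀, ∃ r ∈ R, (a : ↥wreathZ) * r = g)
    (c : Γ₀ →* Multiplicative (Fin 2 → ℤ)) (N : ℕ) (hN : 1 ≤ N)
    (hstep : ∀ r ∈ R, ∀ (i : Fin 2) (σ : ℤˣ), ∃ x : ↥wreathZ,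
      (x ∈ ({aW, bW, cW, dW, sW} : Finset ↥wreathZ) ∨ x⁻¹ ∈ ({aW, bW, cW, dW, sW} : Finset ↥wreathZ)) ∧
      ∃ (a : Γ₀) (r' : ↥wreathZ), r' ∈ R ∧ r * x = (a : ↥wreathZ) * r' ∧ Multiplicative.toAdd (c a) = Pi.single i ((N : ℤ) * σ)) : False :=
  wreathZ_standardGens_not_cosetSteps (fun _ hg => isOfFinOrder_of_mem hg) Γ₀ R hRt hRc c N hN hstep

end Grigorchuk

end Summit.CriticalPhenomena.PercolationContinuityZ3.Theorems.Transplant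

end
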